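import Literature.Barriers.NavierStokesRegularity.HypodissipativeLerayNonuniquenessLerayExistence
import Literature.Analysis.FluidPDE.FractionalNSPrescribedEnergyProfiles
import Literature.Analysis.FluidPDE.FractionalNSPrescribedEnergyProofs
import Literature.Analysis.FluidPDE.FractionalNSEnergyProfileFamily
import HarnessLib

/-!
# Colombo–De Lellis–De Rosa 2018, Thm. 1.3 (the local theorem) from De Rosa 2019, Thm. 2.1

Fourth sibling proof file (definition-free) of the barrier entry
`Literature/Barriers/NavierStokesRegularity/HypodissipativeLerayNonuniqueness` (D-0021), after
`HypodissipativeLerayNonuniquenessProofs` (Colombo–De Lellis–De Rosa 2018, Thm. 1.3 as the named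
fact `ColomboDeLellisDeRosa2018_thm13`; Thm. 1.2 from Thms. 1.1, 1.3),
`HypodissipativeLerayNonuniquenessLerayExistence` (Thm. 1.1 discharged),
`HypodissipativeLerayNonuniquenessLocal` (Thm. 1.3 from the paper's own Prop. 2.2 and Cor. 11.2,
the printed proof of §2) and `HypodissipativeLerayNonuniquenessDeRosaProofs` (De Rosa's Thm. 1.2,
hence CDLDR's Thm. 1.2, from De Rosa's Thm. 2.1).

Thm. 1.3 — for `α < 1/5` a `C^β` datum, `α < β < 1/5`, a time `T > 0` and infinitely many `C^β`
solutions of `∂ₜv + div(v ⊗ v) + ∇p + (-Δ)^α v = 0` on `𝕋³ × [0,T]` from it obeying the energy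
inequality (3) for all `0 ≤ s ≤ t ≤ T` — is STRONGER than Thm. 1.2 (it is the local Hölder
statement behind it), so the reductions of Thm. 1.2 do not cover it. This file proves

* `ColomboDeLellisDeRosa2018_thm13_of_deRosa_thm21 : DeRosa2019_thm21 →
  ColomboDeLellisDeRosa2018_thm13`:

Thm. 1.3 follows from the LATER and stronger prescribed-energy theorem of De Rosa 2019 (Thm. 2.1,
the `1/3`-scheme: for `0 < γ < β < 1/3` and every admissible profile a `C^β` solution on
`𝕋³ × [0,1]` with `∫|v|² = e` and `‖v‖_β ≤ C_β K^{4/9}`, profiles with equal `e(0)` giving equal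
data; named fact `Literature.Analysis.FluidPDE.DeRosa2019_thm21` of
`Literature/Analysis/FluidPDE/FractionalNSPrescribedEnergy`) together with the PROVED Cor. 7.2
(`DeRosa2019_cor72_holds`; = CDLDR Cor. 11.2), by De Rosa's proof of his Thm. 1.2 (§2 p. 5: "For
each `e ∈ 𝓔_K`, we now use Theorem 2.1 … Let `T = 1/4K` … `½(e(s) - e(t)) ≥ (K-1)(t-s)` …
`∫ₛᵗ∫|(-Δ)^{γ/2}v|² ≤ (t-s)C_ε‖v‖²_{γ+ε}` … Chosing `ε` so that `γ + ε = β`, we see that [the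
strict energy inequality] holds if the constant `K` satisfies `K - 1 > C_{β,γ}K^{8/9}`"), run with
`γ = α` and `β = α + ε < 1/5`, which is "precisely" the argument of Colombo–De Lellis–De Rosa for
Thm. 1.3 (§2 p. 5) with Prop. 2.2 replaced by Thm. 2.1. Consequently the named fact
`ColomboDeLellisDeRosa2018_thm13` rests on the single named fact `DeRosa2019_thm21`, exactly as
the catalogue entry `HypodissipativeLerayNonuniqueness` does
(`hypodissipativeLerayNonuniqueness_of_thm21`).

The proof goes through a reusable core lemma, `ColomboDeLellisDeRosa2018_thm13_core`: a sequence
of continuous distributional solutions on `[0,T₀]` with prescribed energies `e n`, a common datum,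
a uniform slice-wise Hölder bound `H`, the dissipation estimate of Cor. 7.2/11.2 with constant
`C₇`, profiles decaying at rate `2C₇H²` on `[0,T]` and separated at one time of `[0,T]`, yields
the twelve conclusions of Thm. 1.3. The profile family is the tree's
`Literature.Analysis.FluidPDE.exists_steepProfileSeq` (`FractionalNSEnergyProfileFamily`: level
`c₀`, slope `-c₀Λ/4` at `0`, `|e'| ≤ c₀ΛA₁`, slope `≤ -c₀Λ/8` on `[0, 1/(2Λ)]`, pairwise different
values at `1/(4Λ)`), at frequency `Λ = L/T₀`, so that De Rosa's `K` is `A₁L`; "choosing `K` big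
enough" is `rpow_mul_rpow_le_of_le` (`aL^p ≤ κL` once `L ≥ (a/κ)^{1/(1-p)}`, here `p = 8/9`).

## Conventions

Those of `Literature/Analysis/FluidPDE/FractionalNSTorus` (unit torus `(ℝ/ℤ)³`, probability Haar
measure, symbol `(2π|k|)^{2α}`, viscosity `1`, energies in `[0,∞]`) and of `DeRosa2019_thm21`
(normalised window `c₀/2 ≤ e ≤ c₀` on `[0,T₀]`, slope bound `c₀K/T₀`).

## References

* M. Colombo, C. De Lellis, L. De Rosa, *Ill-posedness of Leray solutions for the hypodissipative
  Navier–Stokes equations*, Comm. Math. Phys. 362 (2018), 659–688; arXiv:1708.05666, §1 Thm. 1.3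
  (p. 3), §2 proof of Thm. 1.3 (p. 5), §11 Cor. 11.2 (p. 22). [`ColomboDelellisDerosa2018`]
* L. De Rosa, *Infinitely many Leray–Hopf solutions for the fractional Navier–Stokes equations*,
  Comm. PDE 44 (2019), 335–365; arXiv:1801.10235, §2 Thm. 2.1 and the proof of Thm. 1.2 (p. 5),
  §7 Cor. 7.2 (p. 19). [`Derosa2018`]
-/

noncomputable section

open MeasureTheory Set Filter Topology Function
open scoped ENNReal NNReal InnerProductSpace

namespace Literature.Barriers.NavierStokesRegularity

open Literature.Analysis.FluidPDE (DeRosa2019_thm21 DeRosa2019_cor72_holds IsEnergyProfile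
  exists_steepProfileSeq sub_le_of_deriv_le_on_Icc eFracDissipation_le_of_cor72
  fracEnergyIneq_of_profile)
open Literature.Analysis.FluidPDE.Torus (IsWeakFracNSSolutionOn FracEnergyIneq eFracDissipation)
open Literature.Analysis.FunctionSpaces (eBoundedHolderNorm eHolderNorm_le_eBoundedHolderNorm)

/-! ## Elementary helpers -/

section Helpers

/-- A field whose Hölder seminorm is at most the finite constant `C` is `C`-Hölder. [folklore] -/
theorem holderWith_of_eHolderNorm_le {X Y : Type*} [MetricSpace X] [EMetricSpace Y] {r C : ℝ≥0}
    {f : X → Y} (h : eHolderNorm r f ≤ C) : HolderWith C r f := by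
  have hmem : MemHolder r f := eHolderNorm_lt_top.1 (h.trans_lt ENNReal.coe_lt_top)
  have hle : (nnHolderNorm r f : ℝ≥0∞) ≤ C := by rwa [hmem.coe_nnHolderNorm_eq_eHolderNorm]
  intro x y
  exact (hmem.holderWith x y).trans (mul_le_mul' hle le_rfl)

/-- **"Choosing `K` large enough"**: for `a ≥ 0`, `κ > 0`, `p < 1` and `L > 0` with
`L ≥ (a/κ)^{1/(1-p)}` one has `a L^p ≤ κ L`. [folklore] -/
theorem rpow_mul_rpow_le_of_le {a κ p L : ℝ} (ha : 0 ≤ a) (hκ : 0 < κ) (hp : p < 1) (hL : 0 < L)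
    (hLge : (a / κ) ^ (1 - p)⁻¹ ≤ L) : a * L ^ p ≤ κ * L := by
  have h1 : a / κ ≤ L ^ (1 - p) :=
    (Real.rpow_inv_le_iff_of_pos (div_nonneg ha hκ.le) hL.le (sub_pos.2 hp)).1 hLge
  rw [div_le_iff₀ hκ] at h1
  calc a * L ^ p ≤ L ^ (1 - p) * κ * L ^ p := mul_le_mul_of_nonneg_right h1 (Real.rpow_nonneg hL.le _)
    _ = κ * (L ^ (1 - p) * L ^ p) := by ring
    _ = κ * L := by rw [← Real.rpow_add hL, sub_add_cancel, Real.rpow_one]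

/-- The energy inequality between equal times is trivial (`∫ over (t,t) = 0`). [folklore] -/
theorem fracEnergyIneq_self (α : ℝ) (v : ℝ → UnitAddTorus (Fin 3) → EuclideanSpace ℝ (Fin 3))
    (t : ℝ) : FracEnergyIneq α v t t := by
  unfold FracEnergyIneq
  rw [Ioo_self, Measure.restrict_empty, lintegral_zero_measure, add_zero]

end Helpers

/-! ## The core of the printed proof of Thm. 1.3 -/

/-- **Core of the proof of Thm. 1.3** (Colombo–De Lellis–De Rosa 2018, §2 p. 5; the same steps as
De Rosa 2019, §2 p. 5). Let
`0 < α < β < 1/5` (`β = α + ε`), `0 < T ≤ T₀`, and suppose given: profiles `e n` and fields `w n`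
(`n ∈ ℕ`) such that each `w n` is a distributional solution on `𝕋³ × (0,T₀)`, continuous on
`[0,T₀] × 𝕋³`, with `∫‖w n t‖² = e n t` and `‖w n t‖_∞ + [w n t]_β ≤ H` for `t ∈ [0,T₀]`
(prescribed energy and Hölder bound — Prop. 2.2 (a)–(c) / De Rosa Thm. 2.1), all with the same
datum `w n 0` (Prop. 2.2 (d)); the estimate of Cor. 11.2, `∫|(-Δ)^{α/2}f|² ≤ C₇[f]²_β`; the decay
`2C₇H²(t - s) ≤ e n s - e n t` for `0 ≤ s < t ≤ T` ((iv) with "`∫|(-Δ)^{α/2}v|² ≤ K - 1`"); and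
a time `t⋆ ∈ [0,T]` at which the `e n` are pairwise different ((vi)). Then the conclusion of
Thm. 1.3 holds for `α` with datum `w 0 0`, exponent `β`, time `T` and the solutions `w n`: the
datum is in `L²`, weakly divergence free (continuity on the slab) and `C^β`; the `w n` are
continuous on `[0,T] × 𝕋³` with uniformly `β`-Hölder slices, solve the system on `(0,T)`
(restriction), are pairwise distinct on `[0,T]` (different energies at `t⋆`), and obey the energy
inequality (3) for all `0 ≤ s ≤ t ≤ T` (`fracEnergyIneq_of_profile`).
[cite: ColomboDelellisDerosa2018, §2, proof of Thm. 1.3 (p. 5)] -/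
theorem ColomboDeLellisDeRosa2018_thm13_core {α : ℝ} {β : ℝ≥0} {T₀ T H C₇ t₁ : ℝ}
    {e : ℕ → ℝ → ℝ} {w : ℕ → ℝ → UnitAddTorus (Fin 3) → EuclideanSpace ℝ (Fin 3)} (hαβ : α < β)
    (hβ5 : (β : ℝ) < 1 / 5)
    (hT : 0 < T) (hTT₀ : T ≤ T₀) (hH : 0 ≤ H) (hC₇ : 0 ≤ C₇)
    (hweak : ∀ n, IsWeakFracNSSolutionOn T₀ α 1 (w n))
    (hcont : ∀ n, ContinuousOn (uncurry (w n)) (Icc 0 T₀ ×ˢ univ))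
    (hE : ∀ n, ∀ t ∈ Icc 0 T₀, ∫ x, ‖w n t x‖ ^ 2 = e n t)
    (hHol : ∀ n, ∀ t ∈ Icc 0 T₀, eBoundedHolderNorm β (w n t) ≤ ENNReal.ofReal H)
    (h0 : ∀ m n, w m 0 = w n 0)
    (h7 : ∀ f : UnitAddTorus (Fin 3) → EuclideanSpace ℝ (Fin 3), MemHolder β f →
      eFracDissipation α f ≤ ENNReal.ofReal C₇ * eHolderNorm β f ^ 2)
    (hdec : ∀ n s t, 0 ≤ s → s < t → t ≤ T → 2 * (C₇ * H ^ 2) * (t - s) ≤ e n s - e n t)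
    (ht₁ : t₁ ∈ Icc 0 T) (hsep : ∀ m n, m ≠ n → e m t₁ ≠ e n t₁) :
    MemLp (w 0 0) 2 volume ∧ Literature.Analysis.FunctionSpaces.Torus.IsWeaklyDivFree (w 0 0) ∧
      α < β ∧ (β : ℝ) < 1 / 5 ∧ MemHolder β (w 0 0) ∧
      0 < T ∧
      (∀ n, ContinuousOn (uncurry (w n)) (Icc 0 T ×ˢ univ)) ∧
      (∀ n, ∃ C : ℝ≥0, ∀ t ∈ Icc 0 T, HolderWith C β (w n t)) ∧
      (∀ n, w n 0 = w 0 0) ∧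
      (∀ n, IsWeakFracNSSolutionOn T α 1 (w n)) ∧
      (∀ m n, m ≠ n → ∃ t ∈ Icc 0 T, w m t ≠ w n t) ∧
      (∀ n s t, 0 ≤ s → s ≤ t → t ≤ T → FracEnergyIneq α (w n) s t) := by
  have hT₀ : 0 < T₀ := hT.trans_le hTT₀
  have hIcc : Icc (0 : ℝ) T ⊆ Icc 0 T₀ := Icc_subset_Icc_right hTT₀
  have h0mem : (0 : ℝ) ∈ Icc 0 T₀ := ⟨le_rfl, hT₀.le⟩
  -- Hölder seminorm bound on the slices
  have hsemi : ∀ n, ∀ t ∈ Icc 0 T₀, eHolderNorm β (w n t) ≤ (H.toNNReal : ℝ≥0∞) := fun n t ht =>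
    (eHolderNorm_le_eBoundedHolderNorm β (w n t)).trans (hHol n t ht)
  have hmemH : ∀ n, ∀ t ∈ Icc 0 T₀, MemHolder β (w n t) := fun n t ht =>
    eHolderNorm_lt_top.1 ((hsemi n t ht).trans_lt ENNReal.coe_lt_top)
  -- `L²` slices
  have hL2 : ∀ n, ∀ t ∈ Icc 0 T₀, MemLp (w n t) 2 volume := fun n t ht =>
    memLp_slice_of_continuousOn_slab (hcont n) ht
  -- dissipation bound on `[0, T₀]`
  have hdiss : ∀ n, ∀ t ∈ Icc 0 T₀, eFracDissipation α (w n t) ≤ ENNReal.ofReal (C₇ * H ^ 2) :=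
    fun n t ht => eFracDissipation_le_of_cor72 hH h7 (hmemH n t ht) (hHol n t ht)
  refine ⟨hL2 0 0 h0mem, ?_, hαβ, hβ5, hmemH 0 0 h0mem, hT, fun n => (hcont n).mono (prod_mono hIcc subset_rfl),
    fun n => ⟨H.toNNReal, fun t ht => holderWith_of_eHolderNorm_le (hsemi n t (hIcc ht))⟩,
    fun n => h0 n 0, fun n => (hweak n).of_le hTT₀, fun m n hmn => ⟨t₁, ht₁, fun heq => ?_⟩,
    fun n s t hs hst htT => ?_⟩
  · -- the datum is weakly divergence free
    exact isWeaklyDivFree_of_continuousOn_slab hT₀ (hcont 0) (hweak 0).2.2.1 h0mem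
  · -- distinct energies at `t₁` force distinct slices
    have h1 := hE m t₁ (hIcc ht₁)
    rw [heq, hE n t₁ (hIcc ht₁)] at h1
    exact hsep m n hmn h1.symm
  · -- the energy inequality (3) on `[0, T]`
    rcases hst.eq_or_lt with rfl | hst'
    · exact fracEnergyIneq_self α (w n) s
    · exact fracEnergyIneq_of_profile hTT₀ (mul_nonneg hC₇ (sq_nonneg H)) (hL2 n) (hE n) (hdiss n)
        (hdec n) s t hs hst' htT

/-! ## Thm. 1.3 from De Rosa's Thm. 2.1 -/

/-- **Colombo–De Lellis–De Rosa 2018, Thm. 1.3 from De Rosa 2019, Thm. 2.1** (the `1/3`-scheme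
with Hölder bound `‖v‖_β ≤ C_β K^{4/9}`; De Rosa's proof of his Thm. 1.2, §2 p. 5, run for
`γ = α < β = α + ε < 1/5`, `ε = (1/5 - α)/2`): Cor. 7.2 (proved) with constant `C₇`, the steep
profile family `exists_steepProfileSeq` at level `c₀` and frequency `Λ = L/T₀` (slope bound
`c₀A₁L/T₀`, i.e. De Rosa's `K = A₁L`; each member is an admissible profile `IsEnergyProfile c₀ T₀ K`
and all share `e(0) = c₀`, hence the datum), Thm. 2.1's bound `H = CK^{4/9}`, the dissipation bound
`C₇H² = C₇C²K^{8/9} = o(L)` against the decay rate `c₀L/(8T₀)` for `L` large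
(`rpow_mul_rpow_le_of_le`), continuity on the slab from the space–time Hölder class, and
`ColomboDeLellisDeRosa2018_thm13_core` with `T = T₀/(2L)`. Consequently
`ColomboDeLellisDeRosa2018_thm13` rests on the single named fact `DeRosa2019_thm21`.
[cite: Derosa2018, §2 Thm. 2.1 and proof of Thm. 1.2 (p. 5)]
[cite: ColomboDelellisDerosa2018, §1 Thm. 1.3 and §2 proof of Thm. 1.3 (p. 5)] -/
theorem ColomboDeLellisDeRosa2018_thm13_of_deRosa_thm21 (h21 : DeRosa2019_thm21) :
    ColomboDeLellisDeRosa2018_thm13 := by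
  intro α hα hα5
  -- the Hölder exponent `β = α + ε < 1/5 < 1/3`
  set ε : ℝ := (1 / 5 - α) / 2 with hε_def
  have hε : 0 < ε := by rw [hε_def]; linarith
  have hαε5 : α + ε < 1 / 5 := by rw [hε_def]; linarith
  obtain ⟨c₀, T₀, C, hc₀, hT₀, hC, hK⟩ := h21 α (α + ε) hα (by linarith) (by linarith)
  obtain ⟨C₇, hC₇, h7⟩ := DeRosa2019_cor72_holds α ε hα (by linarith) hε (by linarith)
  obtain ⟨A₁, A₂, hA₁, -, hprof⟩ := exists_steepProfileSeq
  -- the large frequency `L` and `K = A₁ L`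
  set κ : ℝ := c₀ / (16 * T₀ * C₇ * C ^ 2) with hκ_def
  have hκ : 0 < κ := by positivity
  set L : ℝ := max 8 ((A₁ ^ (8 / 9 : ℝ) / κ) ^ (1 - 8 / 9 : ℝ)⁻¹) with hL_def
  have hL8 : 8 ≤ L := le_max_left _ _
  have hL : 0 < L := by linarith
  have hkey : A₁ ^ (8 / 9 : ℝ) * L ^ (8 / 9 : ℝ) ≤ κ * L :=
    rpow_mul_rpow_le_of_le (Real.rpow_nonneg (by linarith) _) hκ (by norm_num) hL (le_max_right _ _)
  set K : ℝ := A₁ * L with hK_def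
  have hK1 : 1 < K := by rw [hK_def]; nlinarith
  have hK89 : K ^ (8 / 9 : ℝ) ≤ κ * L := by
    rw [hK_def, Real.mul_rpow (by linarith) hL.le]
    exact hkey
  obtain ⟨v, hv, hv0⟩ := hK K hK1
  -- frequency, window, profiles
  set Λ : ℝ := L / T₀ with hΛ_def
  have hΛ : 0 < Λ := by positivity
  obtain ⟨e, hsmooth, hval, he0, -, hd1, -, hsteep, hdist⟩ := hprof c₀ Λ hc₀ hΛ
  have hprofile : ∀ n, IsEnergyProfile c₀ T₀ K (e n) := fun n =>
    { contDiff := hsmooth n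
      lower := fun t ht => (hval n t ht.1).1
      upper := fun t ht => (hval n t ht.1).2
      abs_deriv_le := fun t _ =>
        calc |deriv (e n) t| ≤ c₀ * Λ * A₁ := hd1 n t
          _ = c₀ * K / T₀ := by rw [hΛ_def, hK_def]; field_simp }
  -- the Hölder bound `H = C K^{4/9}` and the decay
  set H : ℝ := C * K ^ (4 / 9 : ℝ) with hH_def
  have hH : 0 ≤ H := by positivity
  have hrate : 2 * (C₇ * H ^ 2) ≤ c₀ * Λ / 8 := by
    have hsq : (K ^ (4 / 9 : ℝ)) ^ 2 = K ^ (8 / 9 : ℝ) := by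
      rw [← Real.rpow_natCast, ← Real.rpow_mul (by positivity)]
      norm_num
    have h1 : C₇ * H ^ 2 ≤ C₇ * C ^ 2 * (κ * L) := by
      rw [hH_def, mul_pow, hsq, ← mul_assoc]
      exact mul_le_mul_of_nonneg_left hK89 (by positivity)
    have h2 : C₇ * C ^ 2 * (κ * L) = c₀ * Λ / 16 := by
      rw [hκ_def, hΛ_def]
      field_simp
    linarith
  set T : ℝ := 1 / (2 * Λ) with hT_def
  have hT : 0 < T := by positivity
  have hTT₀ : T ≤ T₀ := by
    have h1 : T = T₀ / (2 * L) := by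
      rw [hT_def, hΛ_def]
      field_simp
    rw [h1, div_le_iff₀ (by positivity)]
    nlinarith [mul_le_mul_of_nonneg_left (show (1 : ℝ) ≤ 2 * L by linarith) hT₀.le]
  have hdec : ∀ n s t, 0 ≤ s → s < t → t ≤ T → 2 * (C₇ * H ^ 2) * (t - s) ≤ e n s - e n t := by
    intro n s t hs hst htT
    have hmv := sub_le_of_deriv_le_on_Icc ((hsmooth n).differentiable (by simp))
      (R := c₀ * Λ / 8) (fun x hx => hsteep n x hx) hs hst.le htT
    have hts : 0 ≤ t - s := by linarith
    linarith [mul_le_mul_of_nonneg_right hrate hts]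
  have ht₁ : 1 / (4 * Λ) ∈ Icc 0 T := by
    refine ⟨by positivity, ?_⟩
    rw [hT_def]
    exact one_div_le_one_div_of_le (by positivity) (by linarith)
  -- continuity on the slab from the space–time Hölder class
  have hβpos : 0 < Real.toNNReal (α + ε) := Real.toNNReal_pos.2 (by linarith)
  have hcont : ∀ n, ContinuousOn (uncurry (v (e n))) (Icc 0 T₀ ×ˢ univ) := fun n => by
    obtain ⟨C', hC'⟩ := (hv (e n) (hprofile n)).2.1
    exact hC'.continuousOn hβpos
  have hβ : ((Real.toNNReal (α + ε) : ℝ≥0) : ℝ) = α + ε := Real.coe_toNNReal _ (by linarith)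
  obtain ⟨h1, h2, h3, h4, h5, h6, h7', h8, h9, h10, h11, h12⟩ :=
    ColomboDeLellisDeRosa2018_thm13_core (β := Real.toNNReal (α + ε)) (e := e)
      (w := fun n => v (e n)) (by rw [hβ]; linarith) (by rw [hβ]; linarith) hT hTT₀ hH hC₇.le
      (fun n => (hv (e n) (hprofile n)).1) hcont (fun n => (hv (e n) (hprofile n)).2.2.1)
      (fun n t ht => (hv (e n) (hprofile n)).2.2.2 t ht)
      (fun m n => hv0 (e m) (e n) (hprofile m) (hprofile n) (by rw [he0 m, he0 n])) h7 hdec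
      ht₁ hdist
  exact ⟨v (e 0) 0, Real.toNNReal (α + ε), T, fun n => v (e n), h1, h2, h3, h4, h5, h6, h7', h8,
    h9, h10, h11, h12⟩

end Literature.Barriers.NavierStokesRegularity
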